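import Mathlib.Analysis.SpecialFunctions.Log.Base
import Mathlib.Analysis.SpecialFunctions.Pow.Real
import Literature.Computability.AlgebraicComplexity.MatrixMultiplicationExponent
import Literature.Computability.AlgebraicComplexity.FlatteningBound
import Literature.Computability.AlgebraicComplexity.AsymptoticSpectrum
import Literature.Computability.AlgebraicComplexity.KroneckerRank
import Literature.Computability.AlgebraicComplexity.TensorRankFactsProofs
import HarnessLib

/-!
# Multiples `f ⊙ t`, Kronecker powers and Bläser's Lemma 7.7 (Bläser 2013, §7) — proved

Topic `Literature/Computability/AlgebraicComplexity`; infrastructure for the rank version of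
Schönhage's asymptotic sum inequality (`AsymptoticSumInequality.lean`) and the discharge of
`CohnKleinbergSzegedyUmans2005_5_5_abelian` (`GroupTheoreticMatMulProofs.lean`). Everything here is
PROVED, over a commutative semiring unless a field is needed (flattening, `ω`). Coordinate tensors
`ι → κ → μ → K`, `triad`, `tensorRank = R`, `matMulTensor K k m n = ⟨k,m,n⟩`, `omega K = ω(K)` are
those of `MatrixMultiplicationExponent.lean`; `kroneckerTensor = ⊗`, `kroneckerPow = t^{⊗N}`,
`unitTensor K f = ⟨f⟩` those of `AsymptoticSpectrum.lean`.

## Content (numbering of Bläser 2013)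

* `kroneckerTensor (unitTensor K f) t = f ⊙ t = t ⊕ ⋯ ⊕ t` (Notation 7.6) as the block-diagonal tensor on
  `(Fin f × ι) × (Fin f × κ) × (Fin f × μ)`; `= ⟨f⟩ ⊗ t` (`multiple_eq_kroneckerTensor_unitTensor`).
* `tensorRank_multiple_le : R(f ⊙ t) ≤ f R(t)`; `tensorRank_multiple_mono`;
  `tensorRank_multiple_mul_le : R((qf) ⊙ t) ≤ q R(f ⊙ t)`; `tensorRank_le_tensorRank_multiple`.
* `tensorRank_kroneckerTensor_le_multiple : R(s) ≤ r → R(s ⊗ t') ≤ R(r ⊙ t')` — Lemma 7.3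
  (`R(s) ≤ r ⇔ s ≤ ⟨r⟩`) tensored with `t'`, the step `(f ⊙ ⟨k,m,n⟩) ⊗ ⟨kˢ,mˢ,nˢ⟩ ≤ ⟨g⟩ ⊗ ⟨kˢ,mˢ,nˢ⟩`
  of the proof of Lemma 7.7, proved directly on decompositions.
* `le_tensorRank_multiple : f ≤ R(f ⊙ t)` if `t ≠ 0` (field; slice/flattening bound, proof of
  Lemma 7.1 (2)).
* `tensorRank_kroneckerPow_le : R(t^{⊗N}) ≤ R(t)^N` (Lemma 5.8 iterated).
* `Blaser2013_lemma77_claim`, `Blaser2013_lemma77_rpow`, `Blaser2013_lemma77` — **Lemma 7.7**: "If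
  `R(f ⊙ ⟨k,m,n⟩) ≤ g`, then `ω ≤ 3 log⌈g/f⌉ / log(kmn)`", proved as printed (induction
  `R(f ⊙ ⟨kˢ,mˢ,nˢ⟩) ≤ ⌈g/f⌉ˢ f`, then Thm. 5.9 = `omega_le_three_mul_logb_of_tensorRank_le` and
  `s → ∞`), also in the
  multiplicative form `(kmn)^{ω/3} ≤ q` whenever `R(f ⊙ ⟨k,m,n⟩) ≤ q f` (`f ≥ 1`, `kmn ≥ 2`).

## References

* M. Bläser, *Fast Matrix Multiplication*, Theory of Computing Library, Graduate Surveys 5 (2013),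
  1–60, doi:10.4086/toc.gs.2013.005 (held: `paper:doi-10-4086-toc-gs-2013-005`, read pp. 30–34):
  Def. 7.2, Lemma 7.3 (p. 30), Notation 7.6, Lemma 7.7 and its proof (p. 32). [Blaser2013]

## Design notes

* `ω`-statements are over a field `K : Type u` in any universe (Thm. 5.9 is used in its
  universe-polymorphic form `omega_le_three_mul_logb_of_tensorRank_le` of
  `TensorRankFactsProofs.lean`; the named fact `Blaser2013Thm59` itself quantifies over `K : Type`).
* Lemma 7.7 is printed with `⌈g/f⌉`; the working form takes any `q` with `R(f ⊙ ⟨k,m,n⟩) ≤ q·f`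
  (then `q := ⌈g/f⌉₊` recovers the printed statement, `Blaser2013_lemma77`). The side conditions
  `f ≥ 1`, `kmn ≥ 2` (implicit in print: `log(kmn)` in a denominator, `f` copies) are explicit.
-/

noncomputable section

open scoped BigOperators
open Filter

namespace Literature.Computability.AlgebraicComplexity

universe u

variable {K : Type u} [CommSemiring K]

/-! ## A diagonal-sum helper -/

section Helper

/-- `∑_{i,j,l} [i = j ∧ j = l] g i j l = ∑_i g i i i`. [folklore] -/
theorem sum_sum_sum_ite_eq_eq {α M : Type*} [Fintype α] [DecidableEq α] [AddCommMonoid M]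
    (g : α → α → α → M) :
    (∑ i, ∑ j, ∑ l, if i = j ∧ j = l then g i j l else 0) = ∑ i, g i i i := by
  refine Finset.sum_congr rfl fun i _ => ?_
  rw [Finset.sum_eq_single i, Finset.sum_eq_single i]
  · simp
  · intro l _ hl
    simp [Ne.symm hl]
  · simp
  · intro j _ hj
    exact Finset.sum_eq_zero fun l _ => by simp [Ne.symm hj]
  · simp

end Helper

/-! ## Multiples `f ⊙ t` (Bläser 2013, Notation 7.6) -/

section Multiple

variable {ι κ μ ι' κ' μ' : Type*}

/-- **`f ⊙ t := t ⊕ ⋯ ⊕ t` (`f` times)** (Bläser 2013, Notation 7.6) is written throughout as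
`⟨f⟩ ⊗ t = kroneckerTensor (unitTensor K f) t` (Bläser 2013, proof of Lemma 7.7:
"`⟨g⟩ ⊗ ⟨kˢ,mˢ,nˢ⟩ = g ⊙ ⟨kˢ,mˢ,nˢ⟩`"), the block-diagonal tensor on
`(Fin f × ι) × (Fin f × κ) × (Fin f × μ)`: entry `t a b c` when the three block indices agree, `0`
otherwise. [cite: Blaser2013, Notation 7.6 and Lemma 7.7 (proof)] -/
theorem kroneckerTensor_unitTensor_apply (f : ℕ) (t : ι → κ → μ → K) (a : Fin f × ι)
    (b : Fin f × κ) (c : Fin f × μ) :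
    kroneckerTensor (unitTensor K f) t a b c = if a.1 = b.1 ∧ b.1 = c.1 then t a.2 b.2 c.2 else 0 := by
  simp only [kroneckerTensor_apply, unitTensor_apply, ite_mul, one_mul, zero_mul]

/-- **`R(f ⊙ t) ≤ f · R(t)`** (subadditivity of rank on direct sums; Bläser 2013, §7).
[cite: Blaser2013, §7] -/
theorem tensorRank_multiple_le [Fintype ι] [Fintype κ] [Fintype μ] (f : ℕ) (t : ι → κ → μ → K) :
    tensorRank (kroneckerTensor (unitTensor K f) t) ≤ f * tensorRank t := by
  classical
  obtain ⟨w, u, v, e⟩ := exists_triad_decomposition_tensorRank t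
  have hcard : Fintype.card (Fin f × Fin (tensorRank t)) = f * tensorRank t := by simp
  rw [← hcard]
  refine tensorRank_le_card_of_eq_sum
    (fun p a => if a.1 = p.1 then w p.2 a.2 else 0)
    (fun p b => if b.1 = p.1 then u p.2 b.2 else 0)
    (fun p c => if c.1 = p.1 then v p.2 c.2 else 0) ?_
  funext a b c
  obtain ⟨j₁, a⟩ := a
  obtain ⟨j₂, b⟩ := b
  obtain ⟨j₃, c⟩ := c
  rw [Finset.sum_apply, Finset.sum_apply, Finset.sum_apply, Fintype.sum_prod_type]
  simp only [triad_apply, kroneckerTensor_unitTensor_apply]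
  rw [Finset.sum_eq_single j₁]
  · by_cases h1 : j₁ = j₂
    · subst h1
      by_cases h2 : j₁ = j₃
      · subst h2
        have et := congrFun (congrFun (congrFun e a) b) c
        rw [sum_triad_apply] at et
        simp [et]
      · simp [Ne.symm h2, h2]
    · simp [Ne.symm h1, h1]
  · intro j _ hj
    exact Finset.sum_eq_zero fun l _ => by simp [Ne.symm hj]
  · simp

/-- **Monotonicity in the multiplicity**: `f ≤ f' → R(f ⊙ t) ≤ R(f' ⊙ t)` (`f ⊙ t` is the restriction
of `f' ⊙ t` to the first `f` blocks; Bläser 2013, Lemma 5.4). [cite: Blaser2013, Lemma 5.4] -/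
theorem tensorRank_multiple_mono [Fintype ι] [Fintype κ] [Fintype μ] {f f' : ℕ} (h : f ≤ f')
    (t : ι → κ → μ → K) : tensorRank (kroneckerTensor (unitTensor K f) t) ≤ tensorRank (kroneckerTensor (unitTensor K f') t) := by
  have key : kroneckerTensor (unitTensor K f) t = fun a b c => kroneckerTensor (unitTensor K f') t (Prod.map (Fin.castLE h) id a)
      (Prod.map (Fin.castLE h) id b) (Prod.map (Fin.castLE h) id c) := by
    funext a b c
    simp only [kroneckerTensor_unitTensor_apply, Prod.map_fst, Prod.map_snd, id_eq]
    exact if_congr (by simp [Fin.ext_iff]) rfl rfl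
  rw [key]
  exact tensorRank_precomp_le _ _ _ _

/-- `(q·f) ⊙ t` is (a relabelling of) `q ⊙ (f ⊙ t)`, whence **`R((q f) ⊙ t) ≤ q · R(f ⊙ t)`**
(Bläser 2013, proof of Lemma 7.7: `R(g ⊙ s) ≤ ⌈g/f⌉ · R(f ⊙ s)`). [cite: Blaser2013, Lemma 7.7 (proof)] -/
theorem tensorRank_multiple_mul_le [Fintype ι] [Fintype κ] [Fintype μ] (q f : ℕ)
    (t : ι → κ → μ → K) : tensorRank (kroneckerTensor (unitTensor K (q * f)) t) ≤ q * tensorRank (kroneckerTensor (unitTensor K f) t) := by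
  refine le_trans ?_ (tensorRank_multiple_le q (kroneckerTensor (unitTensor K f) t))
  set e := (finProdFinEquiv (m := q) (n := f)).symm with he
  have key : kroneckerTensor (unitTensor K (q * f)) t = fun a b c => kroneckerTensor (unitTensor K q) (kroneckerTensor (unitTensor K f) t)
      ((e a.1).1, ((e a.1).2, a.2)) ((e b.1).1, ((e b.1).2, b.2)) ((e c.1).1, ((e c.1).2, c.2)) := by
    funext a b c
    simp only [kroneckerTensor_unitTensor_apply]
    rw [← ite_and]
    refine if_congr ?_ rfl rfl
    constructor
    · rintro ⟨h1, h2⟩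
      simp [h1, h2]
    · rintro ⟨⟨h1, h2⟩, h3, h4⟩
      constructor
      · exact e.injective (Prod.ext h1 h3)
      · exact e.injective (Prod.ext h2 h4)
  rw [key]
  exact tensorRank_precomp_le _ _ _ _

/-- `t` is the first block of `f ⊙ t` (`f ≥ 1`), so `R(t) ≤ R(f ⊙ t)`. [cite: Blaser2013, Lemma 5.4] -/
theorem tensorRank_le_tensorRank_multiple [Fintype ι] [Fintype κ] [Fintype μ] {f : ℕ} (hf : 1 ≤ f)
    (t : ι → κ → μ → K) : tensorRank t ≤ tensorRank (kroneckerTensor (unitTensor K f) t) := by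
  have key : t = fun a b c => kroneckerTensor (unitTensor K f) t ((⟨0, hf⟩ : Fin f), a) ((⟨0, hf⟩ : Fin f), b)
      ((⟨0, hf⟩ : Fin f), c) := by
    funext a b c
    simp
  conv_lhs => rw [key]
  exact tensorRank_precomp_le _ _ _ _

/-- **Bläser 2013, Lemma 7.3 tensored with `t'`**: if `R(s) ≤ r` then `s ≤ ⟨r⟩` (restriction), hence
`s ⊗ t' ≤ ⟨r⟩ ⊗ t' = r ⊙ t'` and `R(s ⊗ t') ≤ R(r ⊙ t')` (the step
"`(f ⊙ ⟨k,m,n⟩) ⊗ ⟨kˢ,mˢ,nˢ⟩ ≤ ⟨g⟩ ⊗ ⟨kˢ,mˢ,nˢ⟩`" in the proof of Lemma 7.7).  Proof: substitute a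
decomposition `∑_m W_m ⊗ U_m ⊗ V_m` of `r ⊙ t'` into `s ⊗ t' = ∑_l w_l ⊗ u_l ⊗ v_l ⊗ t'`; the result is
the decomposition `∑_m (∑_l w_l ⊗ W_m(l,·)) ⊗ (∑_l u_l ⊗ U_m(l,·)) ⊗ (∑_l v_l ⊗ V_m(l,·))`.
[cite: Blaser2013, Lemma 7.3 and Lemma 7.7 (proof)] -/
theorem tensorRank_kroneckerTensor_le_multiple [Fintype ι] [Fintype κ] [Fintype μ] [Fintype ι']
    [Fintype κ'] [Fintype μ'] (s : ι → κ → μ → K) (t' : ι' → κ' → μ' → K) {r : ℕ}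
    (hs : tensorRank s ≤ r) : tensorRank (kroneckerTensor s t') ≤ tensorRank (kroneckerTensor (unitTensor K r) t') := by
  classical
  refine le_trans ?_ (tensorRank_multiple_mono hs t')
  obtain ⟨w, u, v, e⟩ := exists_triad_decomposition_tensorRank s
  obtain ⟨W, U, V, e'⟩ := exists_triad_decomposition_tensorRank (kroneckerTensor (unitTensor K (tensorRank s)) t')
  refine tensorRank_le_of_eq_sum
    (fun m a => ∑ l, w l a.1 * W m (l, a.2))
    (fun m b => ∑ l, u l b.1 * U m (l, b.2))
    (fun m c => ∑ l, v l c.1 * V m (l, c.2)) ?_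
  funext a b c
  rw [sum_triad_apply, kroneckerTensor_apply]
  -- expand the right-hand side into a quadruple sum
  have step1 : ∀ m, (∑ l, w l a.1 * W m (l, a.2)) * (∑ l, u l b.1 * U m (l, b.2)) *
      (∑ l, v l c.1 * V m (l, c.2)) = ∑ l₁, ∑ l₂, ∑ l₃, (w l₁ a.1 * u l₂ b.1 * v l₃ c.1) *
        (W m (l₁, a.2) * U m (l₂, b.2) * V m (l₃, c.2)) := by
    intro m
    rw [Finset.sum_mul_sum, Finset.sum_mul]
    refine Finset.sum_congr rfl fun l₁ _ => ?_
    rw [Finset.sum_mul]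
    refine Finset.sum_congr rfl fun l₂ _ => ?_
    rw [Finset.mul_sum]
    exact Finset.sum_congr rfl fun l₃ _ => by ring
  simp_rw [step1]
  rw [Finset.sum_comm]
  simp_rw [Finset.sum_comm (γ := Fin (tensorRank (kroneckerTensor (unitTensor K (tensorRank s)) t')))]
  -- now `∑ l₁, ∑ l₂, ∑ l₃, ∑ m, _`; resum over `m` using the decomposition of `r ⊙ t'`
  have step2 : ∀ l₁ l₂ l₃, (∑ m, (w l₁ a.1 * u l₂ b.1 * v l₃ c.1) *
      (W m (l₁, a.2) * U m (l₂, b.2) * V m (l₃, c.2))) =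
        if l₁ = l₂ ∧ l₂ = l₃ then w l₁ a.1 * u l₂ b.1 * v l₃ c.1 * t' a.2 b.2 c.2 else 0 := by
    intro l₁ l₂ l₃
    rw [← Finset.mul_sum, ← sum_triad_apply W U V, ← e', kroneckerTensor_unitTensor_apply]
    split_ifs <;> simp
  simp_rw [step2]
  rw [sum_sum_sum_ite_eq_eq (fun l₁ l₂ l₃ => w l₁ a.1 * u l₂ b.1 * v l₃ c.1 * t' a.2 b.2 c.2),
    ← Finset.sum_mul]
  congr 1
  conv_lhs => rw [e]
  rw [sum_triad_apply]

/-- **Flattening lower bound for multiples** (over a field): if `t` has a non-zero entry then the `f`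
slices of `f ⊙ t` through that entry are linearly independent, so `f ≤ R(f ⊙ t)` (Bläser 2013, §7,
proof of Lemma 7.1 (2)). [cite: Blaser2013, Lemma 7.1 (2) (proof)] -/
theorem le_tensorRank_multiple {K : Type u} [Field K] [Fintype ι] [Fintype κ] [Fintype μ] (f : ℕ)
    (t : ι → κ → μ → K) {a₀ : ι} {b₀ : κ} {c₀ : μ} (h : t a₀ b₀ c₀ ≠ 0) :
    f ≤ tensorRank (kroneckerTensor (unitTensor K f) t) := by
  classical
  -- the sub-tensor on the first indices `(j, a₀)`
  set T : Fin f → Fin f × κ → Fin f × μ → K := fun j b c => kroneckerTensor (unitTensor K f) t (j, a₀) b c with hT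
  have hle : tensorRank T ≤ tensorRank (kroneckerTensor (unitTensor K f) t) :=
    tensorRank_precomp_le (kroneckerTensor (unitTensor K f) t) (fun j => (j, a₀)) id id
  refine le_trans ?_ hle
  have hli : LinearIndependent K (fun j => T j) := by
    rw [Fintype.linearIndependent_iff]
    intro g hg j₀
    have hj := congr_fun (congr_fun hg (j₀, b₀)) (j₀, c₀)
    rw [Finset.sum_apply, Finset.sum_apply, Finset.sum_eq_single j₀] at hj
    · simpa [hT, h] using hj
    · intro j _ hne
      simp [hT, hne]
    · simp
  simpa using card_le_tensorRank_of_linearIndependent T hli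

end Multiple

/-! ## Kronecker powers -/

section Pow

variable {ι κ μ : Type*}

/-- `t^{⊗(N+1)} ≅ t ⊗ t^{⊗N}` (split off the first coordinate), as a restriction along index maps.
[cite: ChristandlVranaZuiddam2023, §1.1] -/
theorem kroneckerPow_succ_eq (t : ι → κ → μ → K) (N : ℕ) :
    kroneckerPow t (N + 1) = fun a b c =>
      kroneckerTensor t (kroneckerPow t N) (a 0, Fin.tail a) (b 0, Fin.tail b) (c 0, Fin.tail c) := by
  funext a b c
  simp only [kroneckerPow_apply, kroneckerTensor_apply, Fin.prod_univ_succ, Fin.tail]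

/-- **`R(t^{⊗N}) ≤ R(t)^N`** (iterate Bläser 2013, Lemma 5.8). [cite: Blaser2013, Lemma 5.8] -/
theorem tensorRank_kroneckerPow_le [Fintype ι] [Fintype κ] [Fintype μ] (t : ι → κ → μ → K) (N : ℕ) :
    tensorRank (kroneckerPow t N) ≤ tensorRank t ^ N := by
  induction N with
  | zero =>
    rw [pow_zero]
    refine tensorRank_le_of_eq_sum (fun _ _ => 1) (fun _ _ => 1) (fun _ _ => 1) ?_
    funext a b c
    rw [sum_triad_apply]
    simp
  | succ N ih =>
    rw [kroneckerPow_succ_eq, pow_succ]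
    refine (tensorRank_precomp_le _ _ _ _).trans ((Blaser2013_lemma58 _ _).trans ?_)
    rw [mul_comm]
    exact Nat.mul_le_mul_right _ ih

end Pow

/-! ## Bläser 2013, Lemma 7.7 -/

section Lemma77

variable (K)

/-- `f ⊙ ⟨k k', m m', n n'⟩` is a relabelling of `(f ⊙ ⟨k,m,n⟩) ⊗ ⟨k',m',n'⟩` (block index kept, the
matrix indices split by `doubleIndexEquiv`; Bläser 2013, p. 24 and proof of Lemma 7.7:
"`f ⊙ ⟨k^{s+1}, m^{s+1}, n^{s+1}⟩ = (f ⊙ ⟨k,m,n⟩) ⊗ ⟨kˢ,mˢ,nˢ⟩`"). [cite: Blaser2013, Lemma 7.7 (proof)] -/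
theorem multiple_matMulTensor_mul_eq (f k m n k' m' n' : ℕ) :
    kroneckerTensor (unitTensor K f) (matMulTensor K (k * k') (m * m') (n * n')) = fun a b c =>
      kroneckerTensor (kroneckerTensor (unitTensor K f) (matMulTensor K k m n)) (matMulTensor K k' m' n')
        ((a.1, ((doubleIndexEquiv k n k' n').symm a.2).1), ((doubleIndexEquiv k n k' n').symm a.2).2)
        ((b.1, ((doubleIndexEquiv k m k' m').symm b.2).1), ((doubleIndexEquiv k m k' m').symm b.2).2)
        ((c.1, ((doubleIndexEquiv m n m' n').symm c.2).1),
          ((doubleIndexEquiv m n m' n').symm c.2).2) := by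
  funext a b c
  obtain ⟨j₁, A⟩ := a
  obtain ⟨j₂, B⟩ := b
  obtain ⟨j₃, C⟩ := c
  simp only [kroneckerTensor_apply, unitTensor_apply, ite_mul, zero_mul, one_mul]
  refine if_congr Iff.rfl ?_ rfl
  conv_lhs => rw [← (doubleIndexEquiv k n k' n').apply_symm_apply A,
    ← (doubleIndexEquiv k m k' m').apply_symm_apply B,
    ← (doubleIndexEquiv m n m' n').apply_symm_apply C]
  rw [← kroneckerTensor_matMulTensor, kroneckerTensor_apply]

/-- **The claim in the proof of Bläser 2013, Lemma 7.7**: if `R(f ⊙ ⟨k,m,n⟩) ≤ q f` (Bläser: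
`≤ g`, `q = ⌈g/f⌉`) then `R(f ⊙ ⟨kˢ, mˢ, nˢ⟩) ≤ q^{s-1} · (q f)` for all `s ≥ 1` (printed:
`≤ ⌈g/f⌉ˢ f`), by induction: `f ⊙ ⟨k^{s+1},…⟩ = (f ⊙ ⟨k,m,n⟩) ⊗ ⟨kˢ,…⟩ ≤ ⟨q f⟩ ⊗ ⟨kˢ,…⟩ =
(q f) ⊙ ⟨kˢ,…⟩` and `R((q f) ⊙ t) ≤ q R(f ⊙ t)`. Here `s ↦ s + 1`. [cite: Blaser2013, Lemma 7.7 (proof)] -/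
theorem Blaser2013_lemma77_claim {f q k m n : ℕ}
    (h : tensorRank (kroneckerTensor (unitTensor K f) (matMulTensor K k m n)) ≤ q * f) (s : ℕ) :
    tensorRank (kroneckerTensor (unitTensor K f) (matMulTensor K (k ^ (s + 1)) (m ^ (s + 1)) (n ^ (s + 1)))) ≤
      q ^ s * (q * f) := by
  induction s with
  | zero =>
    rw [Nat.zero_add, pow_one, pow_one, pow_one, pow_zero, one_mul]
    exact h
  | succ s ih =>
    rw [pow_succ' k, pow_succ' m, pow_succ' n, multiple_matMulTensor_mul_eq]
    refine (tensorRank_precomp_le _ _ _ _).trans ?_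
    refine (tensorRank_kroneckerTensor_le_multiple _ _ h).trans ?_
    refine (tensorRank_multiple_mul_le q f _).trans ?_
    calc q * tensorRank (kroneckerTensor (unitTensor K f) (matMulTensor K (k ^ (s + 1)) (m ^ (s + 1)) (n ^ (s + 1))))
        ≤ q * (q ^ s * (q * f)) := Nat.mul_le_mul_left q ih
      _ = q ^ (s + 1) * (q * f) := by ring

variable {K}

/-- **Bläser 2013, Lemma 7.7, multiplicative form**: if `R(f ⊙ ⟨k,m,n⟩) ≤ q · f` with `f ≥ 1` and
`kmn ≥ 2`, then `(kmn)^{ω/3} ≤ q` (printed: "If `R(f ⊙ ⟨k,m,n⟩) ≤ g`, then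
`ω ≤ 3 · log ⌈g/f⌉ / log(kmn)`"; take `q = ⌈g/f⌉`).  Proof as printed: the claim above gives
`R(⟨kˢ,mˢ,nˢ⟩) ≤ qˢ f`, Thm. 5.9 gives `ω ≤ (3 s log q + 3 log f)/(s log kmn)` for every `s`, and
`s → ∞`. [cite: Blaser2013, Lemma 7.7] -/
theorem Blaser2013_lemma77_rpow (K : Type u) [Field K] {f q k m n : ℕ} (hf : 1 ≤ f)
    (hkmn : 2 ≤ k * m * n) (h : tensorRank (kroneckerTensor (unitTensor K f) (matMulTensor K k m n)) ≤ q * f) :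
    ((k * m * n : ℕ) : ℝ) ^ (omega K / 3) ≤ q := by
  -- positivity of the format
  have hk : k ≠ 0 := fun hk => by subst hk; simp at hkmn
  have hm : m ≠ 0 := fun hm => by subst hm; simp at hkmn
  have hn : n ≠ 0 := fun hn => by subst hn; simp at hkmn
  haveI : NeZero m := ⟨hm⟩
  -- `q ≥ 1`: `1 ≤ kn ≤ R(⟨k,m,n⟩) ≤ R(f ⊙ ⟨k,m,n⟩) ≤ q f`
  have hq : 1 ≤ q := by
    have h1 : 1 ≤ q * f :=
      calc 1 ≤ k * n := Nat.one_le_iff_ne_zero.2 (mul_ne_zero hk hn)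
        _ ≤ tensorRank (matMulTensor K k m n) := mul_le_tensorRank_matMulTensor K k m n
        _ ≤ tensorRank (kroneckerTensor (unitTensor K f) (matMulTensor K k m n)) := tensorRank_le_tensorRank_multiple hf _
        _ ≤ q * f := h
    rcases Nat.eq_zero_or_pos q with hq0 | hq0
    · subst hq0; simp at h1
    · exact hq0
  -- rank bounds for all powers (Step 1 of the printed proof)
  have hR : ∀ s : ℕ, tensorRank (matMulTensor K (k ^ (s + 1)) (m ^ (s + 1)) (n ^ (s + 1))) ≤
      q ^ (s + 1) * f := by
    intro s
    calc tensorRank (matMulTensor K (k ^ (s + 1)) (m ^ (s + 1)) (n ^ (s + 1)))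
        ≤ tensorRank (kroneckerTensor (unitTensor K f) (matMulTensor K (k ^ (s + 1)) (m ^ (s + 1)) (n ^ (s + 1)))) :=
          tensorRank_le_tensorRank_multiple hf _
      _ ≤ q ^ s * (q * f) := Blaser2013_lemma77_claim K h s
      _ = q ^ (s + 1) * f := by ring
  -- Thm. 5.9 for each power
  set L : ℝ := Real.log ((k * m * n : ℕ) : ℝ) with hL
  have hkmn1 : 1 < k * m * n := hkmn
  have hLpos : 0 < L := Real.log_pos (by exact_mod_cast hkmn1)
  have hq0 : (0 : ℝ) < q := by exact_mod_cast hq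
  have hf0 : (0 : ℝ) < f := by exact_mod_cast hf
  have key : ∀ s : ℕ, omega K ≤ 3 * Real.log q / L + 3 * Real.log f / L / ((s : ℝ) + 1) := by
    intro s
    have hpow : 1 < k ^ (s + 1) * m ^ (s + 1) * n ^ (s + 1) := by
      rw [← mul_pow, ← mul_pow]
      exact Nat.one_lt_pow (Nat.succ_ne_zero s) hkmn1
    have h59 := omega_le_three_mul_logb_of_tensorRank_le K (k ^ (s + 1)) (m ^ (s + 1)) (n ^ (s + 1))
      (q ^ (s + 1) * f)
      hpow (hR s)
    have e1 : ((k ^ (s + 1) * m ^ (s + 1) * n ^ (s + 1) : ℕ) : ℝ) = ((k * m * n : ℕ) : ℝ) ^ (s + 1) := by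
      push_cast; ring
    have e2 : Real.log (((q ^ (s + 1) * f : ℕ) : ℝ)) = ((s : ℝ) + 1) * Real.log q + Real.log f := by
      push_cast
      rw [Real.log_mul (by positivity) hf0.ne', Real.log_pow]
      push_cast
      ring
    rw [e1, Real.logb, Real.log_pow, e2] at h59
    refine h59.trans_eq ?_
    rw [← hL]
    push_cast
    field_simp
  -- `s → ∞`
  have hB : 0 ≤ 3 * Real.log f / L := div_nonneg (by
    have := Real.log_nonneg (by exact_mod_cast hf : (1 : ℝ) ≤ f); linarith) hLpos.le
  have hA : omega K ≤ 3 * Real.log q / L := by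
    refine le_of_forall_pos_lt_add fun ε hε => ?_
    obtain ⟨s, hs⟩ := exists_nat_gt (3 * Real.log f / L / ε)
    have hs1 : 3 * Real.log f / L / ((s : ℝ) + 1) < ε := by
      rw [div_lt_iff₀ (by positivity)]
      rw [div_lt_iff₀ hε] at hs
      nlinarith
    linarith [key s]
  -- back to `(kmn)^{ω/3} ≤ q`
  have hmul : omega K / 3 * L ≤ Real.log q := by
    have h' : omega K * L ≤ 3 * Real.log q := (le_div_iff₀ hLpos).1 hA
    linarith
  have hkmnpos : (0 : ℝ) < ((k * m * n : ℕ) : ℝ) := by exact_mod_cast (zero_lt_one.trans hkmn1)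
  calc ((k * m * n : ℕ) : ℝ) ^ (omega K / 3) = Real.exp (L * (omega K / 3)) :=
        Real.rpow_def_of_pos hkmnpos _
    _ ≤ Real.exp (Real.log q) := Real.exp_le_exp.2 (by rw [mul_comm]; exact hmul)
    _ = q := Real.exp_log hq0

/-- **Bläser 2013, Lemma 7.7** as printed: "If `R(f ⊙ ⟨k, m, n⟩) ≤ g`, then
`ω ≤ 3 · log ⌈g/f⌉ / log(kmn)`" (for `f ≥ 1`, `kmn ≥ 2`; `⌈g/f⌉ = ⌈(g : ℝ)/f⌉₊`).
[cite: Blaser2013, Lemma 7.7] -/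
theorem Blaser2013_lemma77 (K : Type u) [Field K] {f g k m n : ℕ} (hf : 1 ≤ f) (hkmn : 2 ≤ k * m * n)
    (h : tensorRank (kroneckerTensor (unitTensor K f) (matMulTensor K k m n)) ≤ g) :
    omega K ≤ 3 * Real.logb ((k * m * n : ℕ) : ℝ) (⌈(g : ℝ) / f⌉₊ : ℕ) := by
  set q : ℕ := ⌈(g : ℝ) / f⌉₊ with hq
  have hf0 : (0 : ℝ) < f := by exact_mod_cast hf
  have hqf : g ≤ q * f := by
    have h1 : (g : ℝ) / f ≤ q := Nat.le_ceil _
    rw [div_le_iff₀ hf0] at h1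
    exact_mod_cast h1
  have hr := Blaser2013_lemma77_rpow K hf hkmn (h.trans hqf)
  have hkmn1 : 1 < k * m * n := hkmn
  have hkmnpos : (0 : ℝ) < ((k * m * n : ℕ) : ℝ) := by exact_mod_cast (zero_lt_one.trans hkmn1)
  have hLpos : 0 < Real.log ((k * m * n : ℕ) : ℝ) := Real.log_pos (by exact_mod_cast hkmn1)
  have hrpos : 0 < ((k * m * n : ℕ) : ℝ) ^ (omega K / 3) := Real.rpow_pos_of_pos hkmnpos _
  have hlog := Real.log_le_log hrpos hr
  rw [Real.log_rpow hkmnpos] at hlog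
  rw [Real.logb, mul_div_assoc', le_div_iff₀ hLpos]
  linarith

end Lemma77

end Literature.Computability.AlgebraicComplexity

end
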